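import Summits.Schanuel.Schanuel.Theorems.RootDecomp1EWallDichotomy01

/-!
# RootDecomp1EWallDichotomy — lens 2, generation 40 «(c⁗) WALL DICHOTOMY: TWISTED vs UNTWISTED 1-fold SCALES» (BOOKKEEPING node per RULING L1949: wall-text correction + cross-route instance; the twisted side = tree-corollary of lens 4's frame engine, VARIANT-REACH, no cell credit; member z⋄ = zTwin 2 i (√2·λ_H) with a FINITE-irrationality-exponent certificate) — continuation (RootDecomp1EWallDichotomy02): §2b one engine by tree name at β = i + §3 the member `zDia`

(lens-2 g40 `WallDichotomy.lean` [HOME/decomp-schanuel-lens-2/g40/ sha256 beadd3d7…, 1177 l; NODE L1955 / REQUEST L1956; critic VERDICT L1964 (bookkeeping, no credit, port GO low)]; port by census-1 gen 17 as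
`RootDecomp1EWallDichotomy01`–`04` — see the PORT NOTE of part 01; `--supports stmt-Schanuel-31409`; bookkeeping node, no credit; rung 0.)
-/

noncomputable section

open Complex IntermediateField

open Summit.Schanuel.Schanuel.Theorems.RootDecomp1KHyper.HyperCell (HyperLiouville hexp hexp_succ hexp_lt_succ
  one_le_hexp succ_le_hexp lambdaH summable_lambdaH hyperLiouville_lambdaH)
open Summit.Schanuel.Schanuel.Theorems.RootDecomp1BHyperFrame (FrameMeasure frameMeasure_of_roy
  algebraicIndependent_cons_of_frameMeasure trdeg_adjoin_le_of_isAlgebraic' hyperFrame polarVec polarExpo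
  polarDeg_hyperFrame_ge)
open Summit.Schanuel.Schanuel.Theorems.RootDecomp1BFedFlagCore (polarDeg)
open Summit.Schanuel.Schanuel.Theorems.RootDecomp1EPointTransfer (Roy2014_thm_1_1 InPointClass lambdaH_convergent)
open Summit.Schanuel.Schanuel.Theorems.RootDecomp1ELWTransport (zTwin zTwin_left zTwin_right linearIndependent_zTwin
  dblMoments InLWClass DyadicHyper₂)
open Summit.Schanuel.Schanuel.Theorems.RootDecomp1ETwoScale (CoveredTower InTwoScaleClass)
open Summit.Schanuel.Schanuel.Theorems.RootDecomp1EScaleTransfer (InScaleClass HyperScaleApprox)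

namespace Summit.Schanuel.Schanuel.Theorems.RootDecomp1EWallDichotomy

/-! ### §2b  (B1) ONE ENGINE, BY TREE NAME: at `β = i` the twisted moment plane IS lens 4's polar hyper-frame -/

/-- the exponent pattern of the twin is lens 4's doubled pattern `polarExpo (1, …, k)` (by `rfl`) -/
theorem twinExpo_eq_polarExpo (k : ℕ) : twinExpo k = polarExpo (fun j : Fin k => (j : ℕ) + 1) := rfl

/-- at `β = i` and a real scale `T` the moment plane is lens 4's polar vector of the real moment frame
`(T, T², …, T^k)` -/
theorem zTwin_I_eq_polarVec (k : ℕ) (T : ℝ) :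
    zTwin k I T = polarVec (fun j : Fin k => T ^ ((j : ℕ) + 1)) := by
  funext j
  refine Fin.addCases (motive := fun j => zTwin k I T j = polarVec (fun j : Fin k => T ^ ((j : ℕ) + 1)) j)
    (fun i => ?_) (fun i => ?_) j
  · rw [zTwin_left]; unfold polarVec; rw [Fin.append_left]; push_cast; rfl
  · rw [zTwin_right]; unfold polarVec; rw [Fin.append_right]; push_cast; ring

/-- **the twisted moment plane at `β = i` IS the polar vector of lens 4's hyper-scaled frame**
`hyperFrame γ ε ρ` with `γ_j = θ^j`, `ε_j = j`. -/
theorem zTwin_I_twist_eq_polarVec_hyperFrame (k : ℕ) (θ ρ : ℝ) :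
    zTwin k I (θ * ρ) =
      polarVec (hyperFrame (fun j : Fin k => θ ^ ((j : ℕ) + 1)) (fun j => (j : ℕ) + 1) ρ) := by
  rw [zTwin_I_eq_polarVec]
  congr 1
  funext j
  simp [hyperFrame, mul_pow, mul_comm]

/-- lens 4's `polarDeg` of the hyper-scaled moment frame IS the transcendence degree of the twisted moment
plane at `β = i` (definitional). -/
theorem polarDeg_hyperFrame_eq (k : ℕ) (θ ρ : ℝ) :
    polarDeg (hyperFrame (fun j : Fin k => θ ^ ((j : ℕ) + 1)) (fun j => (j : ℕ) + 1) ρ) =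
      Algebra.trdeg ℚ ↥(IntermediateField.adjoin ℚ (Set.range (zTwin k I (θ * ρ)) ∪
        Set.range (cexp ∘ zTwin k I (θ * ρ)))) := by
  rw [zTwin_I_twist_eq_polarVec_hyperFrame]; rfl

/-- **lens 4's TREE THEOREM `polarDeg_hyperFrame_ge` VERBATIM at `β = i`:** surplus one on `zTwin k i (θρ)`
whenever the REAL moment frame `(θ, …, θ^k)` is algebraic and ℚ-free (⇔ `deg_ℚ θ ≥ k` for real algebraic
`θ`), `k ≥ 1`, `ρ` hyper-Liouville. -/
theorem succ_le_trdeg_zTwin_I_of_twisted (hRoy : Roy2014_thm_1_1) {θ : ℝ} (hθ : IsAlgebraic ℚ (θ : ℂ))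
    {k : ℕ} (hk : 0 < k) (hγ : LinearIndependent ℚ (fun j : Fin k => θ ^ ((j : ℕ) + 1))) {ρ : ℝ}
    (hρ : HyperLiouville ρ) :
    ((k + k + 1 : ℕ) : Cardinal) ≤ Algebra.trdeg ℚ
      ↥(IntermediateField.adjoin ℚ (Set.range (zTwin k I (θ * ρ)) ∪
        Set.range (cexp ∘ zTwin k I (θ * ρ)))) := by
  rw [← polarDeg_hyperFrame_eq]
  exact polarDeg_hyperFrame_ge hRoy (fun i => by push_cast; exact hθ.pow _) hγ _ (i₀ := ⟨0, hk⟩) rfl hρ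

/-! ## §3  THE MEMBER `z⋄ = zTwin 2 i (√2·λ_H)` -/

/-- **`T⋄ := √2 · λ_H`** — the TWISTED scale of the member (`λ_H` = lens 6's explicit hyper-Liouville number
`Σ_k 2^{−a_k}`, `a₀ = 1`, `a_{k+1} = 2^{(k+1)a_k}`; `θ = √2`, `ρ = λ_H`). -/
def Tdia : ℝ := Real.sqrt 2 * lambdaH

/-- **`z⋄ := zTwin 2 i T⋄ = (T⋄, T⋄², iT⋄, iT⋄²)`** — a moment E-plane over `E = ℚ(i)` at a TWISTED 1-fold scale. -/
def zDia : Fin (2 + 2) → ℂ := zTwin 2 I Tdia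

/-- `λ_H` is transcendental (it is Liouville: lens 6's `HyperLiouville.liouville` + Mathlib's Liouville theorem). -/
theorem lambdaH_transcendental : Transcendental ℚ lambdaH := fun halg =>
  hyperLiouville_lambdaH.liouville.transcendental ((IsFractionRing.isAlgebraic_iff ℤ ℚ ℝ).mpr halg)

/-- `√2` is algebraic. -/
theorem isAlgebraic_sqrt_two : IsAlgebraic ℚ (Real.sqrt 2) :=
  IsAlgebraic.of_pow two_pos (by rw [Real.sq_sqrt (by norm_num : (0:ℝ) ≤ 2)]; exact isAlgebraic_nat 2)

/-- `(√2 : ℂ)` is algebraic. -/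
theorem isAlgebraic_sqrt_two_complex : IsAlgebraic ℚ ((Real.sqrt 2 : ℝ) : ℂ) := by
  have h := (isAlgebraic_algebraMap_iff (R := ℚ) (A := ℂ) (algebraMap ℝ ℂ).injective).mpr
    isAlgebraic_sqrt_two
  rwa [Complex.coe_algebraMap] at h

/-- `i` is algebraic … -/
theorem isAlgebraic_I : IsAlgebraic ℚ I :=
  IsAlgebraic.of_pow two_pos (by rw [Complex.I_sq]; exact isAlgebraic_one.neg)

/-- … and irrational (not in the image of `ℚ`). -/
theorem I_not_mem_range : I ∉ Set.range (algebraMap ℚ ℂ) := by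
  rintro ⟨r, hr⟩
  have := congrArg Complex.im hr
  simp at this

/-- **`T⋄` is transcendental** (hypothesis-free): `λ_H = T⋄/√2`. -/
theorem Tdia_transcendental_real : Transcendental ℚ Tdia := by
  intro halg
  apply lambdaH_transcendental
  have hs : Real.sqrt 2 ≠ 0 := (Real.sqrt_pos.mpr two_pos).ne'
  have e : lambdaH = (Real.sqrt 2)⁻¹ * Tdia := by unfold Tdia; field_simp
  rw [e]
  exact isAlgebraic_sqrt_two.inv.mul halg

/-- `Transcendental ℚ (T⋄ : ℂ)`. -/
theorem Tdia_transcendental : Transcendental ℚ (Tdia : ℂ) := by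
  have h := (transcendental_algebraMap_iff (R := ℚ) (A := ℂ) (algebraMap ℝ ℂ).injective).mpr
    Tdia_transcendental_real
  rwa [Complex.coe_algebraMap] at h

/-- `0 < T⋄`. -/
theorem Tdia_pos : 0 < Tdia :=
  mul_pos (Real.sqrt_pos.mpr two_pos) (summable_lambdaH.tsum_pos (fun k => by positivity) 0 (by positivity))

/-- **`z⋄` is ℚ-free** (hypothesis-free; g39's tree lemma `linearIndependent_zTwin`). -/
theorem linearIndependent_zDia : LinearIndependent ℚ zDia :=
  linearIndependent_zTwin Tdia_transcendental isAlgebraic_I I_not_mem_range 2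

/-- The four coordinates of `z⋄`. -/
theorem zDia_apply : zDia (Fin.castAdd 2 0) = (Tdia : ℂ) ∧ zDia (Fin.castAdd 2 1) = (Tdia : ℂ) ^ 2 ∧
    zDia (Fin.natAdd 2 0) = I * (Tdia : ℂ) ∧ zDia (Fin.natAdd 2 1) = I * (Tdia : ℂ) ^ 2 := by
  refine ⟨?_, ?_, ?_, ?_⟩
  · rw [zDia, zTwin_left]; simp
  · rw [zDia, zTwin_left]; simp
  · rw [zDia, zTwin_right]; simp
  · rw [zDia, zTwin_right]; simp

/-- **`z⋄` is E-STABLE with `β = i`** (the binder of item 31409): `i · z⋄ ⊆ span_ℚ(z⋄)`. -/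
theorem zDia_Estable : ∃ β : ℂ, IsAlgebraic ℚ β ∧ β ∉ Set.range (algebraMap ℚ ℂ) ∧
    ∀ j, β * zDia j ∈ Submodule.span ℚ (Set.range zDia) := by
  refine ⟨I, isAlgebraic_I, I_not_mem_range, fun j => ?_⟩
  obtain ⟨h0, h1, h2, h3⟩ := zDia_apply
  have hm : ∀ i, zDia i ∈ Submodule.span ℚ (Set.range zDia) := fun i => Submodule.subset_span ⟨i, rfl⟩
  refine Fin.addCases (motive := fun j => I * zDia j ∈ Submodule.span ℚ (Set.range zDia))
    (fun i => ?_) (fun i => ?_) j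
  · -- `i · T⋄^{j}` is the coordinate `i T⋄^{j}`
    have e : I * zDia (Fin.castAdd 2 i) = zDia (Fin.natAdd 2 i) := by rw [zDia, zTwin_left, zTwin_right]
    rw [e]; exact hm _
  · -- `i · (i T⋄^{j}) = − T⋄^{j}`
    have e : I * zDia (Fin.natAdd 2 i) = (-1 : ℚ) • zDia (Fin.castAdd 2 i) := by
      rw [zDia, zTwin_right, zTwin_left, ← mul_assoc, Complex.I_mul_I]; simp [Algebra.smul_def]
    rw [e]; exact Submodule.smul_mem _ _ (hm _)

/-- **The ALGEBRAIC twin at `θ = √2`, `β = i`, `k = 2` is ℚ-free**: `(√2, 2, i√2, 2i)` — the TWIST CONDITION of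
the member, hypothesis-free (`√2 ∉ ℚ`).  More generally: any IRRATIONAL real `θ` at `k = 2`, `β = i`. -/
theorem linearIndependent_zTwin_two_I_of_irrational {θ : ℝ} (hθ : Irrational θ) :
    LinearIndependent ℚ (zTwin 2 I θ) := by
  have hθ0 : θ ≠ 0 := fun h => hθ ⟨0, by simp [h]⟩
  rw [Fintype.linearIndependent_iff]
  intro g hg
  rw [Fin.sum_univ_add] at hg
  simp only [zTwin_left, zTwin_right, Fin.sum_univ_two, Fin.val_zero, Fin.val_one] at hg
  -- real and imaginary parts of the relation
  set a := g (Fin.castAdd 2 0); set b := g (Fin.castAdd 2 1)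
  set c := g (Fin.natAdd 2 0); set d := g (Fin.natAdd 2 1)
  have hre := congrArg Complex.re hg
  have him := congrArg Complex.im hg
  simp [Algebra.smul_def, pow_succ] at hre him
  -- `θ (a + b θ) = 0` and `θ (c + d θ) = 0`
  have hab : (a : ℝ) + b * θ = 0 := by
    have : θ * ((a : ℝ) + b * θ) = 0 := by nlinarith [hre]
    exact (mul_eq_zero.mp this).resolve_left hθ0
  have hcd : (c : ℝ) + d * θ = 0 := by
    have : θ * ((c : ℝ) + d * θ) = 0 := by nlinarith [him]
    exact (mul_eq_zero.mp this).resolve_left hθ0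
  have key : ∀ u v : ℚ, (u : ℝ) + v * θ = 0 → u = 0 ∧ v = 0 := by
    intro u v h
    by_cases hv : v = 0
    · subst hv; simp at h; exact ⟨by exact_mod_cast h, rfl⟩
    · exfalso
      refine hθ ⟨-u / v, ?_⟩
      have hv' : (v : ℝ) ≠ 0 := by exact_mod_cast hv
      push_cast
      field_simp
      linarith
  obtain ⟨ha, hb⟩ := key a b hab
  obtain ⟨hc, hd⟩ := key c d hcd
  intro i
  refine Fin.addCases (motive := fun i => g i = 0) (fun j => ?_) (fun j => ?_) i
  · fin_cases j; exacts [ha, hb]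
  · fin_cases j; exacts [hc, hd]

/-- the twist condition at the member's `θ = √2` -/
theorem linearIndependent_zTwin_two_I_sqrt_two : LinearIndependent ℚ (zTwin 2 I (Real.sqrt 2)) :=
  linearIndependent_zTwin_two_I_of_irrational irrational_sqrt_two

/-- `T⋄ = √2 · λ_H` read as `θ · ρ`. -/
theorem zDia_eq_twist : zDia = zTwin 2 I (Real.sqrt 2 * lambdaH) := rfl

/-- **THE CREDIT LINE — `S` ITSELF at `z⋄`, indeed WITH SURPLUS ONE:**
`5 ≤ trdeg_ℚ ℚ(z⋄, e^{z⋄})` (mod `hRoy` only; 1-fold scale, no transport). -/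
theorem five_le_trdeg_zDia (hRoy : Roy2014_thm_1_1) :
    ((5 : ℕ) : Cardinal) ≤ Algebra.trdeg ℚ
      ↥(IntermediateField.adjoin ℚ (Set.range zDia ∪ Set.range (cexp ∘ zDia))) :=
  succ_le_trdeg_zTwin_of_twisted hRoy isAlgebraic_sqrt_two_complex isAlgebraic_I two_pos
    linearIndependent_zTwin_two_I_sqrt_two hyperLiouville_lambdaH

/-- **`S` at `z⋄`**: `(4 : Cardinal) ≤ trdeg_ℚ ℚ(z⋄, e^{z⋄})` (mod `hRoy`). -/
theorem four_le_trdeg_zDia (hRoy : Roy2014_thm_1_1) :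
    ((4 : ℕ) : Cardinal) ≤ Algebra.trdeg ℚ
      ↥(IntermediateField.adjoin ℚ (Set.range zDia ∪ Set.range (cexp ∘ zDia))) :=
  le_trans (by exact_mod_cast (by norm_num : (4 : ℕ) ≤ 5)) (five_le_trdeg_zDia hRoy)

end Summit.Schanuel.Schanuel.Theorems.RootDecomp1EWallDichotomy

end
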